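import Mathlib
import HarnessLib.Audit

/-!
# Rung C1 of the crux `EulerZoomLiouville.PowerGaugeEulerLiouville`: the planar cone certificate —
# pure linear algebra for an operator `β ⊕ N` on `ℝ³` with `tr N < 0`

Route №10 `EulerZoomLiouville` (NavierStokesRegularity), crux E = stmt-NavierStokesRegularity-19832,
tenure rung C1, registered residue `stub_selfSimilarExtremal`.  Sixth file of the NODAL-FINITENESS
chain (lineage ns-typeII-p2, gen 6): the linear algebra behind the THIN certificate at a VORTICAL
stagnation point (used by `…SelfSimilarFiniteNodalSetExclusion`).

* `coneCertificate_of_invariant_splitting` — for an orthonormal basis `(b₀, b₁, b₂)` of `ℝ³` and an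
  operator `M` with `M b₀ = β b₀` (`β > 0`) and `M bⱼ ∈ span(b₁, b₂)` (`j = 1, 2`) whose `2 × 2` block
  has NEGATIVE TRACE, a strict cone certificate exists: a continuous bilinear form `Q`, a vector `e`
  with `Q(e,e) > 0`, and `η > 0`, `θ ≤ 0` with `Q(Mv,v) + Q(v,Mv) ≤ 2θQ(v,v) − η‖v‖²` for all `v`.
  Proof in coordinates, by the `2 × 2` Cayley–Hamilton identity `K² = (p² + bc)·I` for the traceless
  part `K` of the block (`planar_caseA`–`planar_caseD`): discriminant `< 0` / `= 0` / `> 0` with both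
  roots negative give the form `|x|² + m|Kx|²` contracting on the plane (`θ = 0`); discriminant `> 0`
  with a nonnegative root gives the indefinite form `−⟨x, Kx⟩/s` with `θ = r₁/2` strictly between the
  roots; the `b₀`-coordinate enters with a negative square.

WHAT THIS IS NOT: not NS, not E — finite-dimensional linear algebra only.

## References

* A. Katok, B. Hasselblatt, CUP 1995, §6.2 (cone criterion). [KatokHasselblatt1995]
* P. Constantin, M. Ignatova, V. Vicol, arXiv:2602.17570 (2026), §3.5 (the self-similar setting it
  serves). [ConstantinIgnatovaVicol2026Putative]
-/

noncomputable section

-- flat `Theorems/<Route><Decl>…` files of one crux share the namespace of the crux (tree convention)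
set_option linter.dupNamespace false

open Set Filter Topology Metric Function InnerProductSpace
open scoped RealInnerProductSpace NNReal

namespace Summit.NavierStokesRegularity.NavierStokesRegularity.Theorems.PowerGaugeEulerLiouville.NodalFiniteness

/-! ### Linear algebra: the cone certificate for `β ⊕ N`, `tr N < 0` -/

section Planar

/-- The `3 × 3` coefficient form `Σ_{jk} q_{jk} ⟪b_j, v⟫⟪b_k, w⟫` as a continuous bilinear form. [folklore] -/
private theorem coeffForm_apply (b : OrthonormalBasis (Fin 3) ℝ (EuclideanSpace ℝ (Fin 3)))
    (q : Fin 3 → Fin 3 → ℝ) (v w : EuclideanSpace ℝ (Fin 3)) :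
    (∑ j, ∑ k, q j k • (innerSL ℝ (b j)).smulRight (innerSL ℝ (b k)) :
      EuclideanSpace ℝ (Fin 3) →L[ℝ] EuclideanSpace ℝ (Fin 3) →L[ℝ] ℝ) v w =
      ∑ j, ∑ k, q j k * (⟪b j, v⟫ * ⟪b k, w⟫) := by
  simp only [FunLike.coe_sum, Finset.sum_apply, FunLike.coe_smul,
    Pi.smul_apply, ContinuousLinearMap.smulRight_apply, innerSL_apply_apply, smul_eq_mul]

/-- Case A of the planar certificate (complex roots: `p² + bc < 0`): the form `|x|² + m|Kx|²`,
`m = −1/(p² + bc)`, satisfies `2q̃(Nx, x) = τ q(x)` exactly. [folklore] -/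
private theorem planar_caseA (β τ p b c : ℝ) (hβ : 0 < β) (hτ : τ < 0) (hd : p ^ 2 + b * c < 0) :
    ∃ q₁₁ q₁₂ q₂₂ η θ e₁ e₂ : ℝ, 0 < η ∧ θ ≤ 0 ∧
      0 < q₁₁ * e₁ * e₁ + 2 * q₁₂ * e₁ * e₂ + q₂₂ * e₂ * e₂ ∧
      ∀ x₀ x₁ x₂ : ℝ,
        -2 * β * x₀ ^ 2 + 2 * (q₁₁ * (((τ / 2 + p) * x₁ + b * x₂) * x₁) +
            q₁₂ * (((τ / 2 + p) * x₁ + b * x₂) * x₂ + (c * x₁ + (τ / 2 - p) * x₂) * x₁) +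
            q₂₂ * ((c * x₁ + (τ / 2 - p) * x₂) * x₂)) ≤
          2 * θ * (-x₀ ^ 2 + q₁₁ * x₁ ^ 2 + 2 * q₁₂ * x₁ * x₂ + q₂₂ * x₂ ^ 2) -
            η * (x₀ ^ 2 + x₁ ^ 2 + x₂ ^ 2) := by
  obtain ⟨m, hm⟩ : ∃ m : ℝ, m = -1 / (p ^ 2 + b * c) := ⟨_, rfl⟩
  have hmpos : 0 < m := by rw [hm]; exact div_pos_of_neg_of_neg (by norm_num) hd
  have hmd : m * (p ^ 2 + b * c) = -1 := by rw [hm]; field_simp [hd.ne]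
  refine ⟨1 + m * (p ^ 2 + c ^ 2), m * p * (b - c), 1 + m * (b ^ 2 + p ^ 2), min (-τ) β, 0, 1, 0,
    lt_min (by linarith) hβ, le_rfl, ?_, fun x₀ x₁ x₂ => ?_⟩
  · have : 0 ≤ m * (p ^ 2 + c ^ 2) := by positivity
    nlinarith
  · have key : -2 * β * x₀ ^ 2 + 2 * ((1 + m * (p ^ 2 + c ^ 2)) * (((τ / 2 + p) * x₁ + b * x₂) * x₁) +
          m * p * (b - c) * (((τ / 2 + p) * x₁ + b * x₂) * x₂ + (c * x₁ + (τ / 2 - p) * x₂) * x₁) +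
          (1 + m * (b ^ 2 + p ^ 2)) * ((c * x₁ + (τ / 2 - p) * x₂) * x₂)) =
        -2 * β * x₀ ^ 2 + τ * (x₁ ^ 2 + x₂ ^ 2 + m * ((p * x₁ + b * x₂) ^ 2 + (c * x₁ - p * x₂) ^ 2)) +
          2 * (1 + m * (p ^ 2 + b * c)) * ((p * x₁ + b * x₂) * x₁ + (c * x₁ - p * x₂) * x₂) := by
      ring
    rw [key, hmd]
    have hη1 : min (-τ) β ≤ -τ := min_le_left _ _
    have hη2 : min (-τ) β ≤ β := min_le_right _ _
    have hk : 0 ≤ m * ((p * x₁ + b * x₂) ^ 2 + (c * x₁ - p * x₂) ^ 2) := by positivity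
    have hS : 0 ≤ x₁ ^ 2 + x₂ ^ 2 := by positivity
    have h1 : τ * (m * ((p * x₁ + b * x₂) ^ 2 + (c * x₁ - p * x₂) ^ 2)) ≤ 0 :=
      mul_nonpos_of_nonpos_of_nonneg hτ.le hk
    have h2 : τ * (x₁ ^ 2 + x₂ ^ 2) ≤ -(min (-τ) β) * (x₁ ^ 2 + x₂ ^ 2) := by nlinarith
    have h3 : -2 * β * x₀ ^ 2 ≤ -(min (-τ) β) * x₀ ^ 2 := by nlinarith [sq_nonneg x₀]
    nlinarith

/-- Case B of the planar certificate (double root `τ/2 < 0`: `p² + bc = 0`): the form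
`|x|² + m|Kx|²`, `m = 4/τ²`, with `2⟨Kx,x⟩ ≤ ε|x|² + |Kx|²/ε`, `ε = −τ/2`. [folklore] -/
private theorem planar_caseB (β τ p b c : ℝ) (hβ : 0 < β) (hτ : τ < 0) (hd : p ^ 2 + b * c = 0) :
    ∃ q₁₁ q₁₂ q₂₂ η θ e₁ e₂ : ℝ, 0 < η ∧ θ ≤ 0 ∧
      0 < q₁₁ * e₁ * e₁ + 2 * q₁₂ * e₁ * e₂ + q₂₂ * e₂ * e₂ ∧
      ∀ x₀ x₁ x₂ : ℝ,
        -2 * β * x₀ ^ 2 + 2 * (q₁₁ * (((τ / 2 + p) * x₁ + b * x₂) * x₁) +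
            q₁₂ * (((τ / 2 + p) * x₁ + b * x₂) * x₂ + (c * x₁ + (τ / 2 - p) * x₂) * x₁) +
            q₂₂ * ((c * x₁ + (τ / 2 - p) * x₂) * x₂)) ≤
          2 * θ * (-x₀ ^ 2 + q₁₁ * x₁ ^ 2 + 2 * q₁₂ * x₁ * x₂ + q₂₂ * x₂ ^ 2) -
            η * (x₀ ^ 2 + x₁ ^ 2 + x₂ ^ 2) := by
  obtain ⟨ε, hε⟩ : ∃ ε : ℝ, ε = -τ / 2 := ⟨_, rfl⟩
  have hεpos : 0 < ε := by rw [hε]; linarith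
  obtain ⟨m, hm⟩ : ∃ m : ℝ, m = 1 / ε ^ 2 := ⟨_, rfl⟩
  have hmpos : 0 < m := by rw [hm]; positivity
  have hmε : m * ε = 1 / ε := by rw [hm]; field_simp
  refine ⟨1 + m * (p ^ 2 + c ^ 2), m * p * (b - c), 1 + m * (b ^ 2 + p ^ 2), min ε β, 0, 1, 0,
    lt_min hεpos hβ, le_rfl, ?_, fun x₀ x₁ x₂ => ?_⟩
  · have : 0 ≤ m * (p ^ 2 + c ^ 2) := by positivity
    nlinarith
  · have key : -2 * β * x₀ ^ 2 + 2 * ((1 + m * (p ^ 2 + c ^ 2)) * (((τ / 2 + p) * x₁ + b * x₂) * x₁) +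
          m * p * (b - c) * (((τ / 2 + p) * x₁ + b * x₂) * x₂ + (c * x₁ + (τ / 2 - p) * x₂) * x₁) +
          (1 + m * (b ^ 2 + p ^ 2)) * ((c * x₁ + (τ / 2 - p) * x₂) * x₂)) =
        -2 * β * x₀ ^ 2 + τ * (x₁ ^ 2 + x₂ ^ 2 + m * ((p * x₁ + b * x₂) ^ 2 + (c * x₁ - p * x₂) ^ 2)) +
          2 * (1 + m * (p ^ 2 + b * c)) * ((p * x₁ + b * x₂) * x₁ + (c * x₁ - p * x₂) * x₂) := by
      ring
    rw [key, hd, mul_zero, add_zero, mul_one]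
    set k₁ := p * x₁ + b * x₂ with hk₁
    set k₂ := c * x₁ - p * x₂ with hk₂
    -- AM-GM: `2(k·x) ≤ ε|x|² + |k|²/ε = ε|x|² + ε m |k|²
    have hsos : 2 * (k₁ * x₁ + k₂ * x₂) ≤ ε * (x₁ ^ 2 + x₂ ^ 2) + ε * (m * (k₁ ^ 2 + k₂ ^ 2)) := by
      have h1 : ε * (m * (k₁ ^ 2 + k₂ ^ 2)) = (k₁ ^ 2 + k₂ ^ 2) / ε := by
        rw [show ε * (m * (k₁ ^ 2 + k₂ ^ 2)) = (m * ε) * (k₁ ^ 2 + k₂ ^ 2) by ring, hmε]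
        ring
      rw [h1]
      have h2 : 0 ≤ (ε * x₁ - k₁) ^ 2 / ε + (ε * x₂ - k₂) ^ 2 / ε := by positivity
      have h3 : (ε * x₁ - k₁) ^ 2 / ε + (ε * x₂ - k₂) ^ 2 / ε =
          ε * (x₁ ^ 2 + x₂ ^ 2) + (k₁ ^ 2 + k₂ ^ 2) / ε - 2 * (k₁ * x₁ + k₂ * x₂) := by
        field_simp; ring
      linarith
    have hτε : τ = -2 * ε := by rw [hε]; ring
    have hη1 : min ε β ≤ ε := min_le_left _ _
    have hη2 : min ε β ≤ β := min_le_right _ _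
    have hk : 0 ≤ m * (k₁ ^ 2 + k₂ ^ 2) := by positivity
    have hS : 0 ≤ x₁ ^ 2 + x₂ ^ 2 := by positivity
    have e1 : τ * (x₁ ^ 2 + x₂ ^ 2 + m * (k₁ ^ 2 + k₂ ^ 2)) =
        -2 * (ε * (x₁ ^ 2 + x₂ ^ 2)) - 2 * (ε * (m * (k₁ ^ 2 + k₂ ^ 2))) := by
      rw [hτε]; ring
    have hεk : 0 ≤ ε * (m * (k₁ ^ 2 + k₂ ^ 2)) := by positivity
    have h2 : -(ε * (x₁ ^ 2 + x₂ ^ 2)) ≤ -(min ε β) * (x₁ ^ 2 + x₂ ^ 2) := by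
      have := mul_le_mul_of_nonneg_right hη1 hS
      linarith
    have h3 : -2 * β * x₀ ^ 2 ≤ -(min ε β) * x₀ ^ 2 := by
      have := mul_le_mul_of_nonneg_right hη2 (sq_nonneg x₀)
      nlinarith [sq_nonneg x₀, hβ]
    simp only [mul_zero, zero_mul, zero_sub]
    linarith

/-- Case C of the planar certificate (real roots `τ/2 ± s`, both negative): the form
`|x|² + |Kx|²/s²` with `4⟨Kx,x⟩ ≤ 2(s|x|² + |Kx|²/s)`. [folklore] -/
private theorem planar_caseC (β τ p b c s : ℝ) (hβ : 0 < β) (hs : 0 < s)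
    (hd : p ^ 2 + b * c = s ^ 2) (hr₂ : τ + 2 * s < 0) :
    ∃ q₁₁ q₁₂ q₂₂ η θ e₁ e₂ : ℝ, 0 < η ∧ θ ≤ 0 ∧
      0 < q₁₁ * e₁ * e₁ + 2 * q₁₂ * e₁ * e₂ + q₂₂ * e₂ * e₂ ∧
      ∀ x₀ x₁ x₂ : ℝ,
        -2 * β * x₀ ^ 2 + 2 * (q₁₁ * (((τ / 2 + p) * x₁ + b * x₂) * x₁) +
            q₁₂ * (((τ / 2 + p) * x₁ + b * x₂) * x₂ + (c * x₁ + (τ / 2 - p) * x₂) * x₁) +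
            q₂₂ * ((c * x₁ + (τ / 2 - p) * x₂) * x₂)) ≤
          2 * θ * (-x₀ ^ 2 + q₁₁ * x₁ ^ 2 + 2 * q₁₂ * x₁ * x₂ + q₂₂ * x₂ ^ 2) -
            η * (x₀ ^ 2 + x₁ ^ 2 + x₂ ^ 2) := by
  obtain ⟨m, hm⟩ : ∃ m : ℝ, m = 1 / s ^ 2 := ⟨_, rfl⟩
  have hmpos : 0 < m := by rw [hm]; positivity
  have hmd : m * (p ^ 2 + b * c) = 1 := by rw [hm, hd]; field_simp
  have hms : m * s = 1 / s := by rw [hm]; field_simp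
  refine ⟨1 + m * (p ^ 2 + c ^ 2), m * p * (b - c), 1 + m * (b ^ 2 + p ^ 2), min (-(τ + 2 * s)) β,
    0, 1, 0, lt_min (by linarith) hβ, le_rfl, ?_, fun x₀ x₁ x₂ => ?_⟩
  · have : 0 ≤ m * (p ^ 2 + c ^ 2) := by positivity
    nlinarith
  · have key : -2 * β * x₀ ^ 2 + 2 * ((1 + m * (p ^ 2 + c ^ 2)) * (((τ / 2 + p) * x₁ + b * x₂) * x₁) +
          m * p * (b - c) * (((τ / 2 + p) * x₁ + b * x₂) * x₂ + (c * x₁ + (τ / 2 - p) * x₂) * x₁) +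
          (1 + m * (b ^ 2 + p ^ 2)) * ((c * x₁ + (τ / 2 - p) * x₂) * x₂)) =
        -2 * β * x₀ ^ 2 + τ * (x₁ ^ 2 + x₂ ^ 2 + m * ((p * x₁ + b * x₂) ^ 2 + (c * x₁ - p * x₂) ^ 2)) +
          2 * (1 + m * (p ^ 2 + b * c)) * ((p * x₁ + b * x₂) * x₁ + (c * x₁ - p * x₂) * x₂) := by
      ring
    rw [key, hmd]
    set k₁ := p * x₁ + b * x₂ with hk₁
    set k₂ := c * x₁ - p * x₂ with hk₂
    have hsos : 2 * (k₁ * x₁ + k₂ * x₂) ≤ s * (x₁ ^ 2 + x₂ ^ 2) + s * (m * (k₁ ^ 2 + k₂ ^ 2)) := by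
      have h1 : s * (m * (k₁ ^ 2 + k₂ ^ 2)) = (k₁ ^ 2 + k₂ ^ 2) / s := by
        rw [show s * (m * (k₁ ^ 2 + k₂ ^ 2)) = (m * s) * (k₁ ^ 2 + k₂ ^ 2) by ring, hms]
        ring
      rw [h1]
      have h2 : 0 ≤ (s * x₁ - k₁) ^ 2 / s + (s * x₂ - k₂) ^ 2 / s := by positivity
      have h3 : (s * x₁ - k₁) ^ 2 / s + (s * x₂ - k₂) ^ 2 / s =
          s * (x₁ ^ 2 + x₂ ^ 2) + (k₁ ^ 2 + k₂ ^ 2) / s - 2 * (k₁ * x₁ + k₂ * x₂) := by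
        field_simp; ring
      linarith
    have hη1 : min (-(τ + 2 * s)) β ≤ -(τ + 2 * s) := min_le_left _ _
    have hη2 : min (-(τ + 2 * s)) β ≤ β := min_le_right _ _
    have hk : 0 ≤ m * (k₁ ^ 2 + k₂ ^ 2) := by positivity
    have hS : 0 ≤ x₁ ^ 2 + x₂ ^ 2 := by positivity
    -- `τ q + 4 k·x ≤ (τ + 2s) q ≤ (τ + 2 s)|x|²`
    have h1 : (τ + 2 * s) * (m * (k₁ ^ 2 + k₂ ^ 2)) ≤ 0 :=
      mul_nonpos_of_nonpos_of_nonneg hr₂.le hk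
    have h2 : (τ + 2 * s) * (x₁ ^ 2 + x₂ ^ 2) ≤ -(min (-(τ + 2 * s)) β) * (x₁ ^ 2 + x₂ ^ 2) := by
      nlinarith
    have h3 : -2 * β * x₀ ^ 2 ≤ -(min (-(τ + 2 * s)) β) * x₀ ^ 2 := by nlinarith [sq_nonneg x₀]
    nlinarith

/-- Case D of the planar certificate (real roots `r₁ = τ/2 − s < 0 ≤ r₂ = τ/2 + s`): the indefinite
form `−⟨x, Kx⟩/s` with `θ = r₁/2` strictly between the roots. [folklore] -/
private theorem planar_caseD (β τ p b c s : ℝ) (hβ : 0 < β) (hτ : τ < 0) (hs : 0 < s)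
    (hd : p ^ 2 + b * c = s ^ 2) (hr₂ : 0 ≤ τ + 2 * s) :
    ∃ q₁₁ q₁₂ q₂₂ η θ e₁ e₂ : ℝ, 0 < η ∧ θ ≤ 0 ∧
      0 < q₁₁ * e₁ * e₁ + 2 * q₁₂ * e₁ * e₂ + q₂₂ * e₂ * e₂ ∧
      ∀ x₀ x₁ x₂ : ℝ,
        -2 * β * x₀ ^ 2 + 2 * (q₁₁ * (((τ / 2 + p) * x₁ + b * x₂) * x₁) +
            q₁₂ * (((τ / 2 + p) * x₁ + b * x₂) * x₂ + (c * x₁ + (τ / 2 - p) * x₂) * x₁) +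
            q₂₂ * ((c * x₁ + (τ / 2 - p) * x₂) * x₂)) ≤
          2 * θ * (-x₀ ^ 2 + q₁₁ * x₁ ^ 2 + 2 * q₁₂ * x₁ * x₂ + q₂₂ * x₂ ^ 2) -
            η * (x₀ ^ 2 + x₁ ^ 2 + x₂ ^ 2) := by
  -- `θ = r₁/2`, margin `c₀ = s − (τ/2 + s)/2 > 0`
  obtain ⟨θ, hθ⟩ : ∃ θ : ℝ, θ = (τ / 2 - s) / 2 := ⟨_, rfl⟩
  have hθneg : θ < 0 := by rw [hθ]; linarith
  obtain ⟨c₀, hc₀⟩ : ∃ c₀ : ℝ, c₀ = s - (τ / 2 + s) / 2 := ⟨_, rfl⟩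
  have hc₀pos : 0 < c₀ := by rw [hc₀]; linarith
  -- witness with `−⟨e, Ke⟩ > 0`
  obtain ⟨e₁, e₂, he⟩ : ∃ e₁ e₂ : ℝ, 0 < -(p * e₁ * e₁ + (b + c) * e₁ * e₂ - p * e₂ * e₂) := by
    rcases lt_trichotomy p 0 with hp0 | hp0 | hp0
    · exact ⟨1, 0, by nlinarith⟩
    · have hbc : b + c ≠ 0 := by
        intro h0
        have hc' : c = -b := by linarith
        rw [hp0, hc'] at hd
        nlinarith [sq_nonneg b]
      refine ⟨1, -(b + c), ?_⟩
      rw [hp0]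
      have := pow_pos (abs_pos.2 hbc) 2
      nlinarith [sq_abs (b + c)]
    · exact ⟨0, 1, by nlinarith⟩
  refine ⟨-p / s, -(b + c) / (2 * s), p / s, min c₀ β, θ, e₁, e₂,
    lt_min hc₀pos hβ, hθneg.le, ?_, fun x₀ x₁ x₂ => ?_⟩
  · have e : -p / s * e₁ * e₁ + 2 * (-(b + c) / (2 * s)) * e₁ * e₂ + p / s * e₂ * e₂ =
        -(p * e₁ * e₁ + (b + c) * e₁ * e₂ - p * e₂ * e₂) / s := by
      field_simp; ring
    rw [e]
    exact div_pos he hs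
  · set k₁ := p * x₁ + b * x₂ with hk₁
    set k₂ := c * x₁ - p * x₂ with hk₂
    set A : ℝ := k₁ ^ 2 + k₂ ^ 2 + s ^ 2 * (x₁ ^ 2 + x₂ ^ 2) with hA
    -- `LHS = −2βx₀² + τ q − A/s`, `q = −(k·x)/s`; `Q(x,x) = −x₀² + q`
    have key : -2 * β * x₀ ^ 2 + 2 * (-p / s * (((τ / 2 + p) * x₁ + b * x₂) * x₁) +
          -(b + c) / (2 * s) * (((τ / 2 + p) * x₁ + b * x₂) * x₂ + (c * x₁ + (τ / 2 - p) * x₂) * x₁) +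
          p / s * ((c * x₁ + (τ / 2 - p) * x₂) * x₂)) =
        -2 * β * x₀ ^ 2 + τ * (-(k₁ * x₁ + k₂ * x₂) / s) - A / s := by
      rw [hA, ← hd, hk₁, hk₂]; field_simp; ring
    have hq : -x₀ ^ 2 + -p / s * x₁ ^ 2 + 2 * (-(b + c) / (2 * s)) * x₁ * x₂ + p / s * x₂ ^ 2 =
        -x₀ ^ 2 + -(k₁ * x₁ + k₂ * x₂) / s := by
      rw [hk₁, hk₂]; field_simp; ring
    rw [key, hq]
    have hA0 : 0 ≤ A := by positivity
    -- `2 s |k·x| ≤ A`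
    have hkx : 2 * s * |k₁ * x₁ + k₂ * x₂| ≤ A := by
      rw [hA]
      cases abs_cases (k₁ * x₁ + k₂ * x₂) with
      | inl h => rw [h.1]; nlinarith [sq_nonneg (s * x₁ - k₁), sq_nonneg (s * x₂ - k₂)]
      | inr h => rw [h.1]; nlinarith [sq_nonneg (s * x₁ + k₁), sq_nonneg (s * x₂ + k₂)]
    -- `(τ − 2θ) q ≤ (τ/2 + s) A/(2 s²)` where `τ − 2θ = τ/2 + s ≥ 0`
    have hτθ : τ - 2 * θ = τ / 2 + s := by rw [hθ]; ring
    have hr₂' : 0 ≤ τ / 2 + s := by linarith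
    have hqabs : (τ - 2 * θ) * (-(k₁ * x₁ + k₂ * x₂) / s) ≤ (τ / 2 + s) * (A / (2 * s ^ 2)) := by
      rw [hτθ]
      have h1 : -(k₁ * x₁ + k₂ * x₂) / s ≤ |k₁ * x₁ + k₂ * x₂| / s :=
        div_le_div_of_nonneg_right (neg_le_abs _) hs.le
      have h2 : |k₁ * x₁ + k₂ * x₂| / s ≤ A / (2 * s ^ 2) := by
        rw [div_le_div_iff₀ hs (by positivity)]
        have := mul_le_mul_of_nonneg_left hkx hs.le
        calc |k₁ * x₁ + k₂ * x₂| * (2 * s ^ 2) = s * (2 * s * |k₁ * x₁ + k₂ * x₂|) := by ring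
          _ ≤ s * A := this
          _ = A * s := by ring
      exact mul_le_mul_of_nonneg_left (h1.trans h2) hr₂'
    -- `A/s − (τ/2+s) A/(2s²) = c₀ A/s² ≥ c₀ |x|²`
    have hmain : c₀ * (x₁ ^ 2 + x₂ ^ 2) ≤ A / s - (τ / 2 + s) * (A / (2 * s ^ 2)) := by
      have e1 : A / s - (τ / 2 + s) * (A / (2 * s ^ 2)) = c₀ * A / s ^ 2 := by
        rw [hc₀]; field_simp
      rw [e1, le_div_iff₀ (by positivity)]
      have hAx : s ^ 2 * (x₁ ^ 2 + x₂ ^ 2) ≤ A := by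
        rw [hA]; linarith [sq_nonneg k₁, sq_nonneg k₂]
      calc c₀ * (x₁ ^ 2 + x₂ ^ 2) * s ^ 2 = c₀ * (s ^ 2 * (x₁ ^ 2 + x₂ ^ 2)) := by ring
        _ ≤ c₀ * A := mul_le_mul_of_nonneg_left hAx hc₀pos.le
    have hη1 : min c₀ β ≤ c₀ := min_le_left _ _
    have hη2 : min c₀ β ≤ β := min_le_right _ _
    have hS : 0 ≤ x₁ ^ 2 + x₂ ^ 2 := by positivity
    have h3 : -2 * β * x₀ ^ 2 ≤ 2 * θ * (-x₀ ^ 2) - (min c₀ β) * x₀ ^ 2 := by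
      have h3' : 0 ≤ (2 * β - 2 * θ - min c₀ β) * x₀ ^ 2 :=
        mul_nonneg (by linarith) (sq_nonneg x₀)
      linarith
    -- assemble: `τ q − A/s = 2θ q + (τ−2θ) q − A/s ≤ 2θ q + (τ/2+s)A/(2s²) − A/s ≤ 2θ q − c₀ |x|²`
    have h4 : τ * (-(k₁ * x₁ + k₂ * x₂) / s) - A / s ≤
        2 * θ * (-(k₁ * x₁ + k₂ * x₂) / s) - (min c₀ β) * (x₁ ^ 2 + x₂ ^ 2) := by
      have e2 : τ * (-(k₁ * x₁ + k₂ * x₂) / s) =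
          2 * θ * (-(k₁ * x₁ + k₂ * x₂) / s) + (τ - 2 * θ) * (-(k₁ * x₁ + k₂ * x₂) / s) := by ring
      rw [e2]
      have h5 : (min c₀ β) * (x₁ ^ 2 + x₂ ^ 2) ≤ c₀ * (x₁ ^ 2 + x₂ ^ 2) :=
        mul_le_mul_of_nonneg_right hη1 hS
      linarith
    linarith

/-- **Case analysis on the plane, pure real arithmetic.**  For `β > 0` and a `2 × 2` block
`((τ/2 + p) b; c (τ/2 − p))` with negative trace `τ < 0` there are symmetric coefficients
`q₁₁, q₁₂, q₂₂`, constants `η > 0`, `θ ≤ 0` and a point `(e₁, e₂)` in the open cone, such that for all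
`(x₀, x₁, x₂)` with `(y₁, y₂) = N(x₁, x₂)` and `Q(x,x') = −x₀x₀' + q₁₁x₁x₁' + q₁₂(x₁x₂'+x₂x₁') + q₂₂x₂x₂'`:
`−2βx₀² + 2(q-part of Q(y, x)) ≤ 2θ Q(x, x) − η(x₀² + x₁² + x₂²)`. [folklore] -/
private theorem planar_cone_arith (β τ p b c : ℝ) (hβ : 0 < β) (hτ : τ < 0) :
    ∃ q₁₁ q₁₂ q₂₂ η θ e₁ e₂ : ℝ, 0 < η ∧ θ ≤ 0 ∧
      0 < q₁₁ * e₁ * e₁ + 2 * q₁₂ * e₁ * e₂ + q₂₂ * e₂ * e₂ ∧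
      ∀ x₀ x₁ x₂ : ℝ,
        -2 * β * x₀ ^ 2 + 2 * (q₁₁ * (((τ / 2 + p) * x₁ + b * x₂) * x₁) +
            q₁₂ * (((τ / 2 + p) * x₁ + b * x₂) * x₂ + (c * x₁ + (τ / 2 - p) * x₂) * x₁) +
            q₂₂ * ((c * x₁ + (τ / 2 - p) * x₂) * x₂)) ≤
          2 * θ * (-x₀ ^ 2 + q₁₁ * x₁ ^ 2 + 2 * q₁₂ * x₁ * x₂ + q₂₂ * x₂ ^ 2) -
            η * (x₀ ^ 2 + x₁ ^ 2 + x₂ ^ 2) := by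
  rcases lt_trichotomy (p ^ 2 + b * c) 0 with hdneg | hdzero | hdpos
  · exact planar_caseA β τ p b c hβ hτ hdneg
  · exact planar_caseB β τ p b c hβ hτ hdzero
  · set s : ℝ := Real.sqrt (p ^ 2 + b * c) with hs
    have hspos : 0 < s := Real.sqrt_pos.2 hdpos
    have hs2 : p ^ 2 + b * c = s ^ 2 := (Real.sq_sqrt hdpos.le).symm
    by_cases hr₂ : τ + 2 * s < 0
    · exact planar_caseC β τ p b c s hβ hspos hs2 hr₂
    · exact planar_caseD β τ p b c s hβ hτ hspos hs2 (not_lt.1 hr₂)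

/-- **Cone certificate for an operator with an invariant orthogonal splitting `ℝb₀ ⊕ span(b₁,b₂)`,
`M b₀ = βb₀` (`β > 0`), and NEGATIVE TRACE on the plane.**  Pure linear algebra on `ℝ³`: there are a
continuous bilinear form `Q`, a vector `e` with `Q(e,e) > 0`, and `η > 0`, `θ ≤ 0` with
`Q(Mv,v) + Q(v,Mv) ≤ 2θQ(v,v) − η‖v‖²` for all `v` (the THIN certificate of the nodal-finiteness
chain).  Coordinates in the orthonormal basis reduce it to `planar_cone_arith`. [folklore] -/
theorem coneCertificate_of_invariant_splitting (b : OrthonormalBasis (Fin 3) ℝ (EuclideanSpace ℝ (Fin 3)))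
    (M : EuclideanSpace ℝ (Fin 3) →L[ℝ] EuclideanSpace ℝ (Fin 3)) {β a₁₁ a₁₂ a₂₁ a₂₂ : ℝ}
    (hβ : 0 < β) (h0 : M (b 0) = β • b 0) (h1 : M (b 1) = a₁₁ • b 1 + a₂₁ • b 2)
    (h2 : M (b 2) = a₁₂ • b 1 + a₂₂ • b 2) (htr : a₁₁ + a₂₂ < 0) :
    ∃ (Q : EuclideanSpace ℝ (Fin 3) →L[ℝ] EuclideanSpace ℝ (Fin 3) →L[ℝ] ℝ) (η θ : ℝ)
      (e : EuclideanSpace ℝ (Fin 3)), 0 < η ∧ θ ≤ 0 ∧ 0 < Q e e ∧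
      ∀ v, Q (M v) v + Q v (M v) ≤ 2 * θ * Q v v - η * ‖v‖ ^ 2 := by
  obtain ⟨q₁₁, q₁₂, q₂₂, η, θ, e₁, e₂, hη, hθ, he, hineq⟩ :=
    planar_cone_arith β (a₁₁ + a₂₂) ((a₁₁ - a₂₂) / 2) a₁₂ a₂₁ hβ htr
  have ha₁₁ : (a₁₁ + a₂₂) / 2 + (a₁₁ - a₂₂) / 2 = a₁₁ := by ring
  have ha₂₂ : (a₁₁ + a₂₂) / 2 - (a₁₁ - a₂₂) / 2 = a₂₂ := by ring
  simp only [ha₁₁, ha₂₂] at hineq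
  -- orthonormality facts
  have hon : ∀ i j : Fin 3, ⟪b i, b j⟫ = if i = j then (1 : ℝ) else 0 := fun i j =>
    orthonormal_iff_ite.1 b.orthonormal i j
  -- coordinates of `M v`
  have hexp : ∀ v : EuclideanSpace ℝ (Fin 3),
      M v = ⟪b 0, v⟫ • M (b 0) + ⟪b 1, v⟫ • M (b 1) + ⟪b 2, v⟫ • M (b 2) := by
    intro v
    conv_lhs => rw [← b.sum_repr' v]
    simp only [Fin.sum_univ_three, map_add, map_smul]
  have hc0 : ∀ v, ⟪b 0, M v⟫ = β * ⟪b 0, v⟫ := by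
    intro v
    rw [hexp v, h0, h1, h2]
    simp only [inner_add_right, inner_smul_right, hon]
    simp
    ring
  have hc1 : ∀ v, ⟪b 1, M v⟫ = a₁₁ * ⟪b 1, v⟫ + a₁₂ * ⟪b 2, v⟫ := by
    intro v
    rw [hexp v, h0, h1, h2]
    simp only [inner_add_right, inner_smul_right, hon]
    simp
    ring
  have hc2 : ∀ v, ⟪b 2, M v⟫ = a₂₁ * ⟪b 1, v⟫ + a₂₂ * ⟪b 2, v⟫ := by
    intro v
    rw [hexp v, h0, h1, h2]
    simp only [inner_add_right, inner_smul_right, hon]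
    simp
    ring
  have hnorm : ∀ v : EuclideanSpace ℝ (Fin 3),
      ‖v‖ ^ 2 = ⟪b 0, v⟫ ^ 2 + ⟪b 1, v⟫ ^ 2 + ⟪b 2, v⟫ ^ 2 := by
    intro v
    rw [← real_inner_self_eq_norm_sq, ← b.sum_inner_mul_inner v v, Fin.sum_univ_three,
      real_inner_comm v (b 0), real_inner_comm v (b 1), real_inner_comm v (b 2)]
    ring
  -- the form
  set q : Fin 3 → Fin 3 → ℝ := fun j k =>
    if j = 0 then (if k = 0 then -1 else 0)
    else if j = 1 then (if k = 0 then 0 else if k = 1 then q₁₁ else q₁₂)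
    else (if k = 0 then 0 else if k = 1 then q₁₂ else q₂₂) with hq
  set Q : EuclideanSpace ℝ (Fin 3) →L[ℝ] EuclideanSpace ℝ (Fin 3) →L[ℝ] ℝ :=
    ∑ j, ∑ k, q j k • (innerSL ℝ (b j)).smulRight (innerSL ℝ (b k)) with hQ
  have hQapply : ∀ v w, Q v w = -⟪b 0, v⟫ * ⟪b 0, w⟫ + q₁₁ * ⟪b 1, v⟫ * ⟪b 1, w⟫ +
      q₁₂ * (⟪b 1, v⟫ * ⟪b 2, w⟫ + ⟪b 2, v⟫ * ⟪b 1, w⟫) + q₂₂ * ⟪b 2, v⟫ * ⟪b 2, w⟫ := by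
    intro v w
    rw [hQ, coeffForm_apply]
    simp only [Fin.sum_univ_three, hq]
    simp
    ring
  refine ⟨Q, η, θ, e₁ • b 1 + e₂ • b 2, hη, hθ, ?_, fun v => ?_⟩
  · rw [hQapply]
    simp only [inner_add_right, inner_smul_right, hon]
    simp
    nlinarith [he]
  · rw [hQapply, hQapply, hQapply, hc0, hc1, hc2, hnorm]
    have := hineq ⟪b 0, v⟫ ⟪b 1, v⟫ ⟪b 2, v⟫
    nlinarith [this]

end Planar

end Summit.NavierStokesRegularity.NavierStokesRegularity.Theorems.PowerGaugeEulerLiouville.NodalFiniteness
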